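import Summits.Ventures.LatticeQCDFlow.Exactness.ReversibleVariationalFloor
import Mathlib.Analysis.Complex.AbelLimit
import HarnessLib

/-!
# The variational `τ_int` floor of a reversible sampler under summability, `τ_int(g) ≥ ⟨g, v⟩²/(C_g(0) 𝓔(v)) − ½`, and FROZEN MODES

HONEST FRAMING: exact (Metropolis-corrected) sampling algorithms for lattice gauge theory;
figures of merit are autocorrelation/cost numbers at stated couplings and volumes; no
continuum-physics claim.  (SCALAR calibration rung S0-A: not a gauge result.)

Venture `LatticeQCDFlow` (cell pub-lqcd), topic `Exactness`; FANOUT row 2 (`s0-phi4`).  NEW WORK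
of the cell: Abel's limit theorem (Mathlib `Real.tendsto_tsum_powerSeries_nhdsWithin_lt`) applied
to the unconditional Abel-form floor `RevOp.sq_inner_le_abelSum_mul_quadForm` of
`Exactness/ReversibleVariationalFloor.lean`.  Nothing is cited as a fact; printed counterparts
(Kipnis–Varadhan 1986, Caracciolo–Pelissetto–Sokal 1990, Madras–Slade 1993 Prop. 9.2.2) NAMED ONLY
there.

## What is proved (namespace `RevOp`; `g, v ∈ A`, `C_g(k) = ∫ g (Kᵏ g) w`, `ρ(k) = C_g(k)/C_g(0)`,
`𝓔(v) = ∫ v² w − ∫ v (K v) w`; hypothesis: the autocorrelation series `Σ_{k≥1} ρ(k)` of `g` is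
summable — the tree's standing hypothesis under which `Scoring.tauInt = ½ + Σ_{k≥1} ρ(k)` is a sum)

* `sq_inner_le_tsum_mul_dirichlet` — `(∫ g v w)² ≤ C_g(0) · (Σ_{k≥0} ρ(k)) · 𝓔(v)` for EVERY
  trial observable `v ∈ A` (the limit `r ↑ 1`);
* **`tauInt_ge_variational`** — if `𝓔(v) > 0`: **`τ_int(g) ≥ (∫ g v w)² / (C_g(0) 𝓔(v)) − ½`**.
  With `v = g` this is Madras–Slade's `(1 + ρ(1))/(2(1 − ρ(1)))` (`RevOp.tauInt_ge`); with `v` a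
  carré-du-champ-controlled observable it is every locality / msd floor of the tree; the new cases are
  `v ≠ g` (lattice files: the magnetisation inherits the tunnelling floors of the phase label).
* **`inner_eq_zero_of_summable`** — FROZEN MODES: if `𝓔(v) = 0` (`v` exactly conserved in the
  Dirichlet sense — e.g. `F(O_b)` for a resonant mode of the free-field HMC,
  `Exactness/FreeFieldHMCResonance.lean`), every `g ∈ A` with a summable autocorrelation series
  has `∫ g v w = 0`; **`not_summable_of_inner_ne_zero`** — contrapositive: an observable correlated
  with a frozen mode has a NON-summable autocorrelation series (infinite `τ_int`), whatever else
  the sampler does.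

NOT CLAIMED: summability for any sampler (hypothesis); the equality case; non-reversible updates.
-/

namespace Summit.Ventures.LatticeQCDFlow.Exactness

open Real MeasureTheory Filter Finset Topology
open Summit.Ventures.LatticeQCDFlow.Scoring

namespace RevOp

variable {X : Type*} [MeasurableSpace X] {μ : Measure X} {w : X → ℝ} {A : (X → ℝ) → Prop}
  {K : (X → ℝ) → (X → ℝ)}

/-! ## The `τ_int` floor under summability, and frozen modes -/

/-- **Abel's theorem applied**: if the autocorrelation series of `g` is summable, then for every
trial observable `v ∈ A`: `(∫ g v w)² ≤ C_g(0) · (Σ_{k≥0} ρ(k)) · 𝓔(v)`,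
`𝓔(v) = ∫ v² w − ∫ v (K v) w` (the limit `r ↑ 1` of `sq_inner_le_abelSum_mul_quadForm`). -/
theorem sq_inner_le_tsum_mul_dirichlet (hw0 : ∀ x, 0 ≤ w x)
    (hAi : ∀ ⦃f h : X → ℝ⦄, A f → A h → Integrable (fun x => f x * h x * w x) μ)
    (hAc : ∀ ⦃f h : X → ℝ⦄ (c : ℝ), A f → A h → A (fun x => f x + c * h x))
    (hAK : ∀ ⦃f : X → ℝ⦄, A f → A (K f))
    (hlin : ∀ ⦃f h : X → ℝ⦄ (c : ℝ), A f → A h →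
      ∀ x, K (fun s => f s + c * h s) x = K f x + c * K h x)
    (hsymm : ∀ ⦃f h : X → ℝ⦄, A f → A h →
      ∫ x, K f x * h x * w x ∂μ = ∫ x, f x * K h x * w x ∂μ)
    (hcontr : ∀ ⦃f : X → ℝ⦄, A f → ∫ x, K f x ^ 2 * w x ∂μ ≤ ∫ x, f x ^ 2 * w x ∂μ)
    {g v : X → ℝ} (hg : A g) (hv : A v)
    (hs : Summable fun n => (∫ x, g x * (K^[n + 1] g) x * w x ∂μ) / ∫ x, g x ^ 2 * w x ∂μ) :
    (∫ x, g x * v x * w x ∂μ) ^ 2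
      ≤ (∫ x, g x ^ 2 * w x ∂μ)
        * ((∑' k, (∫ x, g x * (K^[k] g) x * w x ∂μ) / ∫ x, g x ^ 2 * w x ∂μ)
          * ((∫ x, v x ^ 2 * w x ∂μ) - ∫ x, v x * K v x * w x ∂μ)) := by
  set C : ℕ → ℝ := fun k => ∫ x, g x * (K^[k] g) x * w x ∂μ with hC
  set P := ∫ x, g x ^ 2 * w x ∂μ with hPdef
  set E := (∫ x, v x ^ 2 * w x ∂μ) - ∫ x, v x * K v x * w x ∂μ with hEdef
  set B := ∫ x, g x * v x * w x ∂μ with hB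
  have hP0 : 0 ≤ P := integral_nonneg fun x => mul_nonneg (sq_nonneg _) (hw0 x)
  rcases eq_or_lt_of_le hP0 with hz | hPpos
  · -- degenerate `C_g(0) = 0`: then `∫ g v w = 0`
    have hB0 : B = 0 := by
      have hcs := sq_integral_mul_le hw0 hAi hg hv
      rw [← hPdef, ← hz, zero_mul] at hcs
      exact pow_eq_zero_iff (n := 2) (by norm_num) |>.1 (le_antisymm hcs (sq_nonneg _))
    rw [hB0, ← hz]
    simp
  · set ρ : ℕ → ℝ := fun k => C k / P with hρ
    have hsρ : Summable ρ :=
      (summable_nat_add_iff 1).1 (hs.congr fun n => by simp only [hρ, hC, hPdef])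
    have habel : Tendsto (fun x : ℝ => ∑' k, ρ k * x ^ k) (𝓝[<] 1) (𝓝 (∑' k, ρ k)) :=
      Real.tendsto_tsum_powerSeries_nhdsWithin_lt hsρ.hasSum.tendsto_sum_nat
    have hQlim : Tendsto (fun x : ℝ => (∫ x, v x ^ 2 * w x ∂μ) - x * ∫ x, v x * K v x * w x ∂μ)
        (𝓝[<] 1) (𝓝 E) := by
      have hc : Continuous fun x : ℝ => (∫ x, v x ^ 2 * w x ∂μ) - x * ∫ x, v x * K v x * w x ∂μ :=
        continuous_const.sub (continuous_id.mul continuous_const)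
      have := hc.tendsto 1
      rw [one_mul] at this
      exact this.mono_left nhdsWithin_le_nhds
    have hlim := (habel.mul hQlim).const_mul P
    -- the Abel-form inequality holds for every `r ∈ (0, 1)`
    have hev : ∀ᶠ r in 𝓝[<] (1 : ℝ), B ^ 2 ≤ P * ((∑' k, ρ k * r ^ k)
        * ((∫ x, v x ^ 2 * w x ∂μ) - r * ∫ x, v x * K v x * w x ∂μ)) := by
      filter_upwards [Ioo_mem_nhdsLT (show (0 : ℝ) < 1 by norm_num)] with r hr
      have h := sq_inner_le_abelSum_mul_quadForm hw0 hAi hAc hAK hlin hsymm hcontr hg hv hr.1.le hr.2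
      have e : ∑' k, C k * r ^ k = P * ∑' k, ρ k * r ^ k := by
        rw [← tsum_mul_left]
        exact tsum_congr fun k => by simp only [hρ]; field_simp
      rw [e, mul_assoc] at h
      exact h
    exact ge_of_tendsto hlim hev

/-- **THE VARIATIONAL `τ_int` FLOOR.**  `g, v ∈ A`, `C_g(k) = ∫ g (Kᵏ g) w`, `ρ(k) = C_g(k)/C_g(0)`,
`𝓔(v) = ∫ v² w − ∫ v (K v) w`.  If the autocorrelation series of `g` is summable (so that
`τ_int = ½ + Σ_{k≥1} ρ(k)` is its sum) and `𝓔(v) > 0`, then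
`τ_int(g) ≥ (∫ g v w)² / (C_g(0) · 𝓔(v)) − ½`. -/
theorem tauInt_ge_variational (hw0 : ∀ x, 0 ≤ w x)
    (hAi : ∀ ⦃f h : X → ℝ⦄, A f → A h → Integrable (fun x => f x * h x * w x) μ)
    (hAc : ∀ ⦃f h : X → ℝ⦄ (c : ℝ), A f → A h → A (fun x => f x + c * h x))
    (hAK : ∀ ⦃f : X → ℝ⦄, A f → A (K f))
    (hlin : ∀ ⦃f h : X → ℝ⦄ (c : ℝ), A f → A h →
      ∀ x, K (fun s => f s + c * h s) x = K f x + c * K h x)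
    (hsymm : ∀ ⦃f h : X → ℝ⦄, A f → A h →
      ∫ x, K f x * h x * w x ∂μ = ∫ x, f x * K h x * w x ∂μ)
    (hcontr : ∀ ⦃f : X → ℝ⦄, A f → ∫ x, K f x ^ 2 * w x ∂μ ≤ ∫ x, f x ^ 2 * w x ∂μ)
    {g v : X → ℝ} (hg : A g) (hv : A v)
    (hs : Summable fun n => (∫ x, g x * (K^[n + 1] g) x * w x ∂μ) / ∫ x, g x ^ 2 * w x ∂μ)
    (hE : 0 < (∫ x, v x ^ 2 * w x ∂μ) - ∫ x, v x * K v x * w x ∂μ) :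
    (∫ x, g x * v x * w x ∂μ) ^ 2
          / ((∫ x, g x ^ 2 * w x ∂μ) * ((∫ x, v x ^ 2 * w x ∂μ) - ∫ x, v x * K v x * w x ∂μ))
        - 1 / 2
      ≤ tauInt (fun n => (∫ x, g x * (K^[n] g) x * w x ∂μ) / ∫ x, g x ^ 2 * w x ∂μ) := by
  set C : ℕ → ℝ := fun k => ∫ x, g x * (K^[k] g) x * w x ∂μ with hC
  set P := ∫ x, g x ^ 2 * w x ∂μ with hPdef
  set E := (∫ x, v x ^ 2 * w x ∂μ) - ∫ x, v x * K v x * w x ∂μ with hEdef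
  set B := ∫ x, g x * v x * w x ∂μ with hB
  have hmain := sq_inner_le_tsum_mul_dirichlet hw0 hAi hAc hAK hlin hsymm hcontr hg hv hs
  have hP0 : 0 ≤ P := integral_nonneg fun x => mul_nonneg (sq_nonneg _) (hw0 x)
  have htau : tauInt (fun n => C n / P) = 1 / 2 + ∑' k, C (k + 1) / P := by simp only [tauInt]
  rw [htau]
  rcases eq_or_lt_of_le hP0 with hz | hPpos
  · have hρ0 : ∀ k, C (k + 1) / P = 0 := fun k => by rw [← hz, div_zero]
    rw [tsum_congr hρ0, tsum_zero, ← hz, zero_mul, div_zero]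
    norm_num
  · have hsρ : Summable fun k => C k / P := (summable_nat_add_iff 1).1 hs
    have hC0 : C 0 / P = 1 := by
      have : C 0 = P := by
        simp only [hC, hPdef, Function.iterate_zero, id_eq]
        exact integral_congr_ae (Eventually.of_forall fun x => by ring)
      rw [this, div_self hPpos.ne']
    have hsum : ∑' k, C k / P = 1 + ∑' k, C (k + 1) / P := by
      rw [hsρ.tsum_eq_zero_add, hC0]
    rw [hsum] at hmain
    have hPE : 0 < P * E := mul_pos hPpos hE
    have : B ^ 2 / (P * E) ≤ 1 + ∑' k, C (k + 1) / P := by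
      rw [div_le_iff₀ hPE]
      nlinarith [hmain]
    linarith

/-- **FROZEN MODES**: if `v ∈ A` is exactly conserved by the sampler in the Dirichlet sense
(`𝓔(v) = ∫ v² w − ∫ v (K v) w = 0`), then every `g ∈ A` whose autocorrelation series is summable is
UNCORRELATED with `v`: `∫ g v w = 0`. -/
theorem inner_eq_zero_of_summable (hw0 : ∀ x, 0 ≤ w x)
    (hAi : ∀ ⦃f h : X → ℝ⦄, A f → A h → Integrable (fun x => f x * h x * w x) μ)
    (hAc : ∀ ⦃f h : X → ℝ⦄ (c : ℝ), A f → A h → A (fun x => f x + c * h x))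
    (hAK : ∀ ⦃f : X → ℝ⦄, A f → A (K f))
    (hlin : ∀ ⦃f h : X → ℝ⦄ (c : ℝ), A f → A h →
      ∀ x, K (fun s => f s + c * h s) x = K f x + c * K h x)
    (hsymm : ∀ ⦃f h : X → ℝ⦄, A f → A h →
      ∫ x, K f x * h x * w x ∂μ = ∫ x, f x * K h x * w x ∂μ)
    (hcontr : ∀ ⦃f : X → ℝ⦄, A f → ∫ x, K f x ^ 2 * w x ∂μ ≤ ∫ x, f x ^ 2 * w x ∂μ)
    {g v : X → ℝ} (hg : A g) (hv : A v)
    (hs : Summable fun n => (∫ x, g x * (K^[n + 1] g) x * w x ∂μ) / ∫ x, g x ^ 2 * w x ∂μ)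
    (hE : (∫ x, v x ^ 2 * w x ∂μ) - ∫ x, v x * K v x * w x ∂μ = 0) :
    ∫ x, g x * v x * w x ∂μ = 0 := by
  have h := sq_inner_le_tsum_mul_dirichlet hw0 hAi hAc hAK hlin hsymm hcontr hg hv hs
  rw [hE, mul_zero, mul_zero] at h
  exact pow_eq_zero_iff (n := 2) (by norm_num) |>.1 (le_antisymm h (sq_nonneg _))

/-- **Contrapositive: an observable correlated with a frozen mode does not decorrelate summably.**
If `𝓔(v) = 0` and `∫ g v w ≠ 0` then the normalised autocorrelation series of `g` is NOT summable
(its integrated autocorrelation time is infinite). -/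
theorem not_summable_of_inner_ne_zero (hw0 : ∀ x, 0 ≤ w x)
    (hAi : ∀ ⦃f h : X → ℝ⦄, A f → A h → Integrable (fun x => f x * h x * w x) μ)
    (hAc : ∀ ⦃f h : X → ℝ⦄ (c : ℝ), A f → A h → A (fun x => f x + c * h x))
    (hAK : ∀ ⦃f : X → ℝ⦄, A f → A (K f))
    (hlin : ∀ ⦃f h : X → ℝ⦄ (c : ℝ), A f → A h →
      ∀ x, K (fun s => f s + c * h s) x = K f x + c * K h x)
    (hsymm : ∀ ⦃f h : X → ℝ⦄, A f → A h →
      ∫ x, K f x * h x * w x ∂μ = ∫ x, f x * K h x * w x ∂μ)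
    (hcontr : ∀ ⦃f : X → ℝ⦄, A f → ∫ x, K f x ^ 2 * w x ∂μ ≤ ∫ x, f x ^ 2 * w x ∂μ)
    {g v : X → ℝ} (hg : A g) (hv : A v)
    (hE : (∫ x, v x ^ 2 * w x ∂μ) - ∫ x, v x * K v x * w x ∂μ = 0)
    (hB : ∫ x, g x * v x * w x ∂μ ≠ 0) :
    ¬ Summable fun n => (∫ x, g x * (K^[n + 1] g) x * w x ∂μ) / ∫ x, g x ^ 2 * w x ∂μ :=
  fun hs => hB (inner_eq_zero_of_summable hw0 hAi hAc hAK hlin hsymm hcontr hg hv hs hE)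

end RevOp

end Summit.Ventures.LatticeQCDFlow.Exactness
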